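import Mathlib
import HarnessLib

/-!
# Route `PoloidalWindowDoor`, item `LrcModEntire` (stmt-NavierStokesRegularity-20428), cell (Q4-curved) of the (TH) column —
# B-ELIM: ELIMINATION OF THE TANGENTIAL COMPONENT FROM THE CURVED CAUCHY–RIEMANN PAIR, AND THE FIRST INTEGRAL (‡) OF THE CURVATURE TOWER

Cell ns-regularity-ideate, helper seat ns-k2-port-2 g9 under the LEAD of item 20428 (ns-poloidal-K2-p3 g17).  Memo `Cruxes/LrcModEntire/TOWER-CLOSES-port2g9.md` §A
(verified by refuter1 g25 DUTY-C13, (A2) by sympy kit j336716) and `Cruxes/LrcModEntire/T2B-g17.md` §6(6c), §13–§14; `--supports stmt-NavierStokesRegularity-20428 --as helper`.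
CLASS-FREE one-variable calculus in JET VARIABLES: every partial derivative is a separate function `ℝ → ℝ → ℝ` of `(s,m)`, linked to its primitive by a `HasDerivAt`
hypothesis along the `s`-line or the `m`-line on an open rectangle `S × W`; Schwarz for `P` is the hypothesis that the SAME function `Psm` is the `m`-derivative of `P_s` and the
`s`-derivative of `P_m`.  (At assembly these links come from `C^∞` functions of two variables.)

SETTING (T2B-g17 §6(6a)–(6c)).  `k` (signed curvature of the base branch, function of `s`), `t` (the horizontal trace `2τ`, function of `m`), `J := 1 − k(s)·m`; the normal and
tangential sheet components `h, P` with the curved Cauchy–Riemann pair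
  (1′) `h_s = J·P_m − k·P`,   (2′) `P_s = −J·h_m + k·h + J·t(m)`   on `S × W`.

* `pi_formula` — **(E1) `k′·P = −k′m·h_s + J·Ξ`**, `Ξ := 3Jk·h_m − J²·h_mm − 2Jk·t + J²·t′ − k²·h − h_ss` (from `∂_m(2′)`, `∂_s(1′)`, Schwarz for `P`, and (1′) once more:
  `J(mP_m + P) = m h_s + P`).  No division by `k′`.
* `tower_identity_abstract` — **(E2)** differentiating (E1) along `m` and using `k′·(1′)`:
  `0 = −J k′ h_s − J k′ m h_sm − 2Jk·Ξ + J²·Ξ_m + k k′ m h_s − k′ h_s`, `Ξ_m := −4k² h_m + 5Jk h_mm − J² h_mmm + 2k² t − 4Jk t′ + J² t″ − h_ssm` — a LOCAL third-order identity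
  in the jets of `h` alone (any `h`, `P` with (1′)(2′)).
* ★ `tower_first_integral` — for **`h = α(s) + g(m) − c(m)·k(s)/J`** (the cross-web velocity of T2B-g17 §6(6b)) the identity (E2) is the FIRST INTEGRAL (‡) of the curvature
  tower, stated directly in the polynomial currency (P) of T2B-g17 §14 / B-POLE:
  **`k″·c′(m)·J² + k′²·(3m·c′(m)·J + 4c(m)) − Z(s)·J³ + J³·(e₀(m) + e₁(m)k + e₂(m)k² + e₃(m)k³) = 0`**, `Z := −2(kα″ − k′α′ + k³α)`,
  `e₀ = −σ₃`, `e₁ = σ₂ + 3mσ₃`, `e₂ = −2σ₁ − 2mσ₂ − 3m²σ₃`, `e₃ = 2u + 2mσ₁ + m²σ₂ + m³σ₃` with `u = g + c′`, `σ₁ = 5g′ + 2c″ − 3t`, `σ₂ = 7g″ + c‴ − 6t′`, `σ₃ = g‴ − t″`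
  (all functions of `m` ONLY) — i.e. (‡)×J²: `ξ·a_m(κ) + υ·b_m(κ) − Z·j_m(κ)³ + q_m(κ) = 0` at `κ = k(s)` with `a_m = c′(1−κm)²`, `b_m = 3mc′(1−κm) + 4c`, `j_m = 1 − κm`,
  `q_m = j_m³·Ẽ(·,m)` a polynomial of degree ≤ 6 in `κ` vanishing at `κ = 1/m`.

WHAT THIS IS NOT: not a claim about Navier–Stokes regularity and not a stub of the registry; class-free calculus for the residual research cells
`stub_Q4curvedAperiodic` / `stub_Q4sonicLineNegIsolated` of `Cruxes/LrcModEntire/Lines/twist_split.lean` (v14; bears_on LADDER-NS N0 via item 20428; items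
20428 / 19708 / 27893 OPEN).
-/

noncomputable section

set_option linter.dupNamespace false
set_option linter.style.longLine false

namespace Summit.NavierStokesRegularity.NavierStokesRegularity.Theorems.PoloidalWindowDoorLrcModEntireCurvedTowerElim

open Set Function Filter Topology

/-! ### A. Jet-variable elimination -/

section abstractElim

variable {S W : Set ℝ} {k k1 t t1 t2 : ℝ → ℝ}
  {h hs hss hm hmm hmmm hsm hssm P Ps Pm Psm : ℝ → ℝ → ℝ}

/-- **(E1) the `Π`-formula `k′·P = −k′m·h_s + J·Ξ`.**  Hypotheses: the jets along the two coordinate lines on the open rectangle `S × W`, Schwarz for `P`, and the curved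
Cauchy–Riemann pair (1′)(2′). -/
theorem pi_formula (hS : IsOpen S) (hW : IsOpen W)
    (hk : ∀ s ∈ S, HasDerivAt k (k1 s) s)
    (ht : ∀ m ∈ W, HasDerivAt t (t1 m) m)
    (h_ss : ∀ s ∈ S, ∀ m ∈ W, HasDerivAt (fun s' => hs s' m) (hss s m) s)
    (h_m : ∀ s ∈ S, ∀ m ∈ W, HasDerivAt (fun m' => h s m') (hm s m) m)
    (h_mm : ∀ s ∈ S, ∀ m ∈ W, HasDerivAt (fun m' => hm s m') (hmm s m) m)
    (P_s : ∀ s ∈ S, ∀ m ∈ W, HasDerivAt (fun s' => P s' m) (Ps s m) s)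
    (P_sm : ∀ s ∈ S, ∀ m ∈ W, HasDerivAt (fun m' => Ps s m') (Psm s m) m)
    (P_ms : ∀ s ∈ S, ∀ m ∈ W, HasDerivAt (fun s' => Pm s' m) (Psm s m) s)
    (h1 : ∀ s ∈ S, ∀ m ∈ W, hs s m = (1 - k s * m) * Pm s m - k s * P s m)
    (h2 : ∀ s ∈ S, ∀ m ∈ W, Ps s m = -(1 - k s * m) * hm s m + k s * h s m + (1 - k s * m) * t m)
    {s m : ℝ} (hsS : s ∈ S) (hmW : m ∈ W) :
    k1 s * P s m = -(k1 s * m * hs s m) + (1 - k s * m) *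
      (3 * (1 - k s * m) * k s * hm s m - (1 - k s * m) ^ 2 * hmm s m - 2 * (1 - k s * m) * k s * t m + (1 - k s * m) ^ 2 * t1 m
        - k s ^ 2 * h s m - hss s m) := by
  /- (i) `∂_m` of (2′) along the `m`-line through `(s, m)` -/
  have h2ev : (fun m' => -(1 - k s * m') * hm s m' + k s * h s m' + (1 - k s * m') * t m') =ᶠ[𝓝 m] fun m' => Ps s m' := by
    filter_upwards [hW.mem_nhds hmW] with m' hm' using (h2 s hsS m' hm').symm
  have hJm : HasDerivAt (fun m' : ℝ => 1 - k s * m') (-(k s)) m := by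
    simpa using ((hasDerivAt_id m).const_mul (k s)).const_sub 1
  have hR2 : HasDerivAt (fun m' => -(1 - k s * m') * hm s m' + k s * h s m' + (1 - k s * m') * t m')
      (-(-(k s) * hm s m + (1 - k s * m) * hmm s m) + k s * hm s m + (-(k s) * t m + (1 - k s * m) * t1 m)) m := by
    have key := ((hJm.mul (h_mm s hsS m hmW)).neg.add ((h_m s hsS m hmW).const_mul (k s))).add (hJm.mul (ht m hmW))
    have hfun : (fun m' => -(1 - k s * m') * hm s m' + k s * h s m' + (1 - k s * m') * t m') =
        (fun m' => -((1 - k s * m') * hm s m') + k s * h s m' + (1 - k s * m') * t m') := by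
      funext m'; ring
    rw [hfun]
    exact key.congr_deriv (by ring)
  have hi : Psm s m = -(-(k s) * hm s m + (1 - k s * m) * hmm s m) + k s * hm s m + (-(k s) * t m + (1 - k s * m) * t1 m) :=
    (P_sm s hsS m hmW).unique (hR2.congr_of_eventuallyEq h2ev.symm)
  /- (ii) `∂_s` of (1′) along the `s`-line through `(s, m)` -/
  have h1ev : (fun s' => (1 - k s' * m) * Pm s' m - k s' * P s' m) =ᶠ[𝓝 s] fun s' => hs s' m := by
    filter_upwards [hS.mem_nhds hsS] with s' hs' using (h1 s' hs' m hmW).symm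
  have hJs : HasDerivAt (fun s' : ℝ => 1 - k s' * m) (-(k1 s * m)) s := by
    simpa using ((hk s hsS).mul_const m).const_sub 1
  have hR1 : HasDerivAt (fun s' => (1 - k s' * m) * Pm s' m - k s' * P s' m)
      ((-(k1 s * m) * Pm s m + (1 - k s * m) * Psm s m) - (k1 s * P s m + k s * Ps s m)) s :=
    (hJs.mul (P_ms s hsS m hmW)).sub ((hk s hsS).mul (P_s s hsS m hmW))
  have hii : hss s m = (-(k1 s * m) * Pm s m + (1 - k s * m) * Psm s m) - (k1 s * P s m + k s * Ps s m) :=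
    (h_ss s hsS m hmW).unique (hR1.congr_of_eventuallyEq h1ev.symm)
  /- (iii) algebra with (1′), (2′) at the point -/
  have e1 := h1 s hsS m hmW
  have e2 := h2 s hsS m hmW
  linear_combination k1 s * m * e1 + (1 - k s * m) * hii + (1 - k s * m) ^ 2 * hi - (1 - k s * m) * k s * e2

/-- **(E2) the abstract third-order identity** obtained by differentiating (E1) along `m` and using `k′·(1′)`. -/
theorem tower_identity_abstract (hS : IsOpen S) (hW : IsOpen W)
    (hk : ∀ s ∈ S, HasDerivAt k (k1 s) s)
    (ht : ∀ m ∈ W, HasDerivAt t (t1 m) m) (ht2 : ∀ m ∈ W, HasDerivAt t1 (t2 m) m)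
    (h_ss : ∀ s ∈ S, ∀ m ∈ W, HasDerivAt (fun s' => hs s' m) (hss s m) s)
    (h_m : ∀ s ∈ S, ∀ m ∈ W, HasDerivAt (fun m' => h s m') (hm s m) m)
    (h_mm : ∀ s ∈ S, ∀ m ∈ W, HasDerivAt (fun m' => hm s m') (hmm s m) m)
    (h_mmm : ∀ s ∈ S, ∀ m ∈ W, HasDerivAt (fun m' => hmm s m') (hmmm s m) m)
    (h_sm : ∀ s ∈ S, ∀ m ∈ W, HasDerivAt (fun m' => hs s m') (hsm s m) m)
    (h_ssm : ∀ s ∈ S, ∀ m ∈ W, HasDerivAt (fun m' => hss s m') (hssm s m) m)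
    (P_s : ∀ s ∈ S, ∀ m ∈ W, HasDerivAt (fun s' => P s' m) (Ps s m) s)
    (P_m : ∀ s ∈ S, ∀ m ∈ W, HasDerivAt (fun m' => P s m') (Pm s m) m)
    (P_sm : ∀ s ∈ S, ∀ m ∈ W, HasDerivAt (fun m' => Ps s m') (Psm s m) m)
    (P_ms : ∀ s ∈ S, ∀ m ∈ W, HasDerivAt (fun s' => Pm s' m) (Psm s m) s)
    (h1 : ∀ s ∈ S, ∀ m ∈ W, hs s m = (1 - k s * m) * Pm s m - k s * P s m)
    (h2 : ∀ s ∈ S, ∀ m ∈ W, Ps s m = -(1 - k s * m) * hm s m + k s * h s m + (1 - k s * m) * t m)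
    {s m : ℝ} (hsS : s ∈ S) (hmW : m ∈ W) :
    0 = -((1 - k s * m) * k1 s * hs s m) - (1 - k s * m) * k1 s * m * hsm s m
        - 2 * (1 - k s * m) * k s *
            (3 * (1 - k s * m) * k s * hm s m - (1 - k s * m) ^ 2 * hmm s m - 2 * (1 - k s * m) * k s * t m + (1 - k s * m) ^ 2 * t1 m
              - k s ^ 2 * h s m - hss s m)
        + (1 - k s * m) ^ 2 *
            (-(4 * k s ^ 2 * hm s m) + 5 * (1 - k s * m) * k s * hmm s m - (1 - k s * m) ^ 2 * hmmm s m + 2 * k s ^ 2 * t m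
              - 4 * (1 - k s * m) * k s * t1 m + (1 - k s * m) ^ 2 * t2 m - hssm s m)
        + k s * k1 s * m * hs s m - k1 s * hs s m := by
  -- the function `Ξ` and the right side of (E1)
  set Ξ : ℝ → ℝ := fun m' => 3 * (1 - k s * m') * k s * hm s m' - (1 - k s * m') ^ 2 * hmm s m' - 2 * (1 - k s * m') * k s * t m'
    + (1 - k s * m') ^ 2 * t1 m' - k s ^ 2 * h s m' - hss s m' with hΞdef
  set Ξ' : ℝ := -(4 * k s ^ 2 * hm s m) + 5 * (1 - k s * m) * k s * hmm s m - (1 - k s * m) ^ 2 * hmmm s m + 2 * k s ^ 2 * t m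
    - 4 * (1 - k s * m) * k s * t1 m + (1 - k s * m) ^ 2 * t2 m - hssm s m with hΞ'def
  -- (E1) on the whole `m`-line through `s`
  have hE1 : ∀ m' ∈ W, k1 s * P s m' = -(k1 s * m' * hs s m') + (1 - k s * m') * Ξ m' := fun m' hm' => by
    rw [hΞdef]
    exact pi_formula hS hW hk ht h_ss h_m h_mm P_s P_sm P_ms h1 h2 hsS hm'
  have hev : (fun m' => -(k1 s * m' * hs s m') + (1 - k s * m') * Ξ m') =ᶠ[𝓝 m] fun m' => k1 s * P s m' := by
    filter_upwards [hW.mem_nhds hmW] with m' hm' using (hE1 m' hm').symm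
  -- derivative of the left side
  have hL : HasDerivAt (fun m' => k1 s * P s m') (k1 s * Pm s m) m := (P_m s hsS m hmW).const_mul (k1 s)
  -- derivative of `Ξ`
  have hJm : HasDerivAt (fun m' : ℝ => 1 - k s * m') (-(k s)) m := by
    simpa using ((hasDerivAt_id m).const_mul (k s)).const_sub 1
  have hΞ : HasDerivAt Ξ Ξ' m := by
    have hA : HasDerivAt (fun m' => (1 - k s * m') * k s * hm s m') (-(k s) * k s * hm s m + (1 - k s * m) * k s * hmm s m) m :=
      (hJm.mul_const (k s)).mul (h_mm s hsS m hmW)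
    have hB : HasDerivAt (fun m' => (1 - k s * m') ^ 2 * hmm s m')
        (((2 : ℕ) : ℝ) * (1 - k s * m) ^ (2 - 1) * (-(k s)) * hmm s m + (1 - k s * m) ^ 2 * hmmm s m) m :=
      (hJm.pow 2).mul (h_mmm s hsS m hmW)
    have hC : HasDerivAt (fun m' => (1 - k s * m') * k s * t m') (-(k s) * k s * t m + (1 - k s * m) * k s * t1 m) m :=
      (hJm.mul_const (k s)).mul (ht m hmW)
    have hD : HasDerivAt (fun m' => (1 - k s * m') ^ 2 * t1 m')
        (((2 : ℕ) : ℝ) * (1 - k s * m) ^ (2 - 1) * (-(k s)) * t1 m + (1 - k s * m) ^ 2 * t2 m) m :=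
      (hJm.pow 2).mul (ht2 m hmW)
    have hE : HasDerivAt (fun m' => k s ^ 2 * h s m') (k s ^ 2 * hm s m) m := (h_m s hsS m hmW).const_mul _
    have hF := h_ssm s hsS m hmW
    have key := (((((hA.const_mul 3).sub hB).sub (hC.const_mul 2)).add hD).sub hE).sub hF
    have hfun : Ξ = fun m' => 3 * ((1 - k s * m') * k s * hm s m') - (1 - k s * m') ^ 2 * hmm s m' - 2 * ((1 - k s * m') * k s * t m')
        + (1 - k s * m') ^ 2 * t1 m' - k s ^ 2 * h s m' - hss s m' := by
      funext m'; simp only [hΞdef]; ring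
    rw [hfun]
    refine key.congr_deriv ?_
    simp only [hΞ'def]
    push_cast
    ring
  -- derivative of the right side of (E1)
  have hR : HasDerivAt (fun m' => -(k1 s * m' * hs s m') + (1 - k s * m') * Ξ m')
      (-(k1 s * 1 * hs s m + k1 s * m * hsm s m) + (-(k s) * Ξ m + (1 - k s * m) * Ξ')) m :=
    (((hasDerivAt_id m).const_mul (k1 s)).mul (h_sm s hsS m hmW)).neg.add (hJm.mul hΞ)
  have hiv : k1 s * Pm s m = -(k1 s * 1 * hs s m + k1 s * m * hsm s m) + (-(k s) * Ξ m + (1 - k s * m) * Ξ') :=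
    hL.unique (hR.congr_of_eventuallyEq hev.symm)
  have e1 := h1 s hsS m hmW
  have hE1p := hE1 m hmW
  have hΞm : Ξ m = 3 * (1 - k s * m) * k s * hm s m - (1 - k s * m) ^ 2 * hmm s m - 2 * (1 - k s * m) * k s * t m
      + (1 - k s * m) ^ 2 * t1 m - k s ^ 2 * h s m - hss s m := by simp only [hΞdef]
  rw [hΞm] at hiv hE1p
  rw [hΞ'def] at hiv
  linear_combination k1 s * e1 + (1 - k s * m) * hiv - k s * hE1p

end abstractElim

/-! ### B. The first integral (‡) for `h = α + g − c k/J`, in the polynomial currency (P) -/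

section explicitElim

variable {S W : Set ℝ} {k k1 k2 α α1 α2 c c1 c2 c3 g g1 g2 g3 t t1 t2 : ℝ → ℝ} {P Ps Pm Psm : ℝ → ℝ → ℝ}

/-- Quotient rule along a line: the derivative of `y ↦ u(y)/Jf(y)ⁿ` where `Jf` has derivative `J'` and value `Jv ≠ 0`. -/
theorem hasDerivAt_div_pow {u Jf : ℝ → ℝ} {u' Jv J' x : ℝ} (n : ℕ) (hu : HasDerivAt u u' x) (hJf : HasDerivAt Jf J' x)
    (hJx : Jf x = Jv) (hJv : Jv ≠ 0) :
    HasDerivAt (fun y => u y / Jf y ^ n) (u' / Jv ^ n - n * u x * J' / Jv ^ (n + 1)) x := by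
  have hpow : HasDerivAt (fun y => Jf y ^ n) ((n : ℝ) * Jf x ^ (n - 1) * J') x := hJf.pow n
  have hne : Jf x ^ n ≠ 0 := by rw [hJx]; exact pow_ne_zero n hJv
  have h := hu.div hpow hne
  refine h.congr_deriv ?_
  rw [hJx]
  rcases n with _ | n
  · simp
  · rw [show n + 1 - 1 = n from rfl]
    field_simp
    push_cast
    ring

/-- ★ **THE FIRST INTEGRAL (‡) OF THE CURVATURE TOWER** (T2B-g17 §6 / TOWER-CLOSES §A), in the polynomial currency (P) of T2B-g17 §14: if the cross-web velocity is
`h(s,m) = α(s) + g(m) − c(m)k(s)/(1 − k(s)m)` on the open rectangle `S × W` (with `1 − k(s)m ≠ 0` there) and `P` solves the curved Cauchy–Riemann pair (1′)(2′) with it,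
then at every `(s,m) ∈ S × W`, with `J = 1 − k(s)m`:
`k″(s)·c′(m)·J² + k′(s)²·(3m·c′(m)·J + 4c(m)) − Z(s)·J³ + J³·(e₀(m) + e₁(m)k(s) + e₂(m)k(s)² + e₃(m)k(s)³) = 0`,
`Z = −2(kα″ − k′α′ + k³α)`, `e₀…e₃` the explicit `m`-only coefficients of the module docstring.  (Only the link `α′ ↦ α″` is needed: `α′` itself enters through the
left side of (1′), which IS `h_s`.) -/
theorem tower_first_integral (hS : IsOpen S) (hW : IsOpen W)
    (hk : ∀ s ∈ S, HasDerivAt k (k1 s) s) (hk2 : ∀ s ∈ S, HasDerivAt k1 (k2 s) s)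
    (hα2 : ∀ s ∈ S, HasDerivAt α1 (α2 s) s)
    (hc : ∀ m ∈ W, HasDerivAt c (c1 m) m) (hc2 : ∀ m ∈ W, HasDerivAt c1 (c2 m) m) (hc3 : ∀ m ∈ W, HasDerivAt c2 (c3 m) m)
    (hg : ∀ m ∈ W, HasDerivAt g (g1 m) m) (hg2 : ∀ m ∈ W, HasDerivAt g1 (g2 m) m) (hg3 : ∀ m ∈ W, HasDerivAt g2 (g3 m) m)
    (ht : ∀ m ∈ W, HasDerivAt t (t1 m) m) (ht2 : ∀ m ∈ W, HasDerivAt t1 (t2 m) m)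
    (hJ : ∀ s ∈ S, ∀ m ∈ W, 1 - k s * m ≠ 0)
    (P_s : ∀ s ∈ S, ∀ m ∈ W, HasDerivAt (fun s' => P s' m) (Ps s m) s)
    (P_m : ∀ s ∈ S, ∀ m ∈ W, HasDerivAt (fun m' => P s m') (Pm s m) m)
    (P_sm : ∀ s ∈ S, ∀ m ∈ W, HasDerivAt (fun m' => Ps s m') (Psm s m) m)
    (P_ms : ∀ s ∈ S, ∀ m ∈ W, HasDerivAt (fun s' => Pm s' m) (Psm s m) s)
    (h1 : ∀ s ∈ S, ∀ m ∈ W, α1 s - c m * k1 s / (1 - k s * m) ^ 2 = (1 - k s * m) * Pm s m - k s * P s m)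
    (h2 : ∀ s ∈ S, ∀ m ∈ W, Ps s m = -(1 - k s * m) * (g1 m - k s * c1 m / (1 - k s * m) - k s ^ 2 * c m / (1 - k s * m) ^ 2)
      + k s * (α s + g m - c m * k s / (1 - k s * m)) + (1 - k s * m) * t m)
    {s m : ℝ} (hsS : s ∈ S) (hmW : m ∈ W) :
    k2 s * c1 m * (1 - k s * m) ^ 2 + k1 s ^ 2 * (3 * m * c1 m * (1 - k s * m) + 4 * c m)
        - (-2 * (k s * α2 s - k1 s * α1 s + k s ^ 3 * α s)) * (1 - k s * m) ^ 3
        + (1 - k s * m) ^ 3 *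
          (-(g3 m - t2 m)
            + ((7 * g2 m + c3 m - 6 * t1 m) + 3 * m * (g3 m - t2 m)) * k s
            + (-2 * (5 * g1 m + 2 * c2 m - 3 * t m) - 2 * m * (7 * g2 m + c3 m - 6 * t1 m) - 3 * m ^ 2 * (g3 m - t2 m)) * k s ^ 2
            + (2 * (g m + c1 m) + 2 * m * (5 * g1 m + 2 * c2 m - 3 * t m) + m ^ 2 * (7 * g2 m + c3 m - 6 * t1 m) + m ^ 3 * (g3 m - t2 m)) * k s ^ 3) = 0 := by
  /- the jets of `h = α + g − c k/J` as explicit functions -/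
  set h : ℝ → ℝ → ℝ := fun s m => α s + g m - c m * k s / (1 - k s * m) with hh
  set hs : ℝ → ℝ → ℝ := fun s m => α1 s - c m * k1 s / (1 - k s * m) ^ 2 with hhs
  set hss : ℝ → ℝ → ℝ := fun s m => α2 s - c m * k2 s / (1 - k s * m) ^ 2 - 2 * c m * m * k1 s ^ 2 / (1 - k s * m) ^ 3 with hhss
  set hm : ℝ → ℝ → ℝ := fun s m => g1 m - k s * c1 m / (1 - k s * m) - k s ^ 2 * c m / (1 - k s * m) ^ 2 with hhm
  set hmm : ℝ → ℝ → ℝ := fun s m => g2 m - k s * c2 m / (1 - k s * m) - 2 * k s ^ 2 * c1 m / (1 - k s * m) ^ 2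
    - 2 * k s ^ 3 * c m / (1 - k s * m) ^ 3 with hhmm
  set hmmm : ℝ → ℝ → ℝ := fun s m => g3 m - k s * c3 m / (1 - k s * m) - 3 * k s ^ 2 * c2 m / (1 - k s * m) ^ 2
    - 6 * k s ^ 3 * c1 m / (1 - k s * m) ^ 3 - 6 * k s ^ 4 * c m / (1 - k s * m) ^ 4 with hhmmm
  set hsm : ℝ → ℝ → ℝ := fun s m => -(c1 m * k1 s / (1 - k s * m) ^ 2) - 2 * c m * k s * k1 s / (1 - k s * m) ^ 3 with hhsm
  set hssm : ℝ → ℝ → ℝ := fun s m => -(c1 m * k2 s / (1 - k s * m) ^ 2) - 2 * c m * k s * k2 s / (1 - k s * m) ^ 3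
    - 2 * (c1 m * m + c m) * k1 s ^ 2 / (1 - k s * m) ^ 3 - 6 * c m * m * k s * k1 s ^ 2 / (1 - k s * m) ^ 4 with hhssm
  /- derivative of `J` along each coordinate line -/
  have hJm : ∀ s m, HasDerivAt (fun m' : ℝ => 1 - k s * m') (-(k s)) m := fun s m => by
    simpa using ((hasDerivAt_id m).const_mul (k s)).const_sub 1
  have hJs : ∀ s ∈ S, ∀ m, HasDerivAt (fun s' : ℝ => 1 - k s' * m) (-(k1 s * m)) s := fun s hsS' m => by
    simpa using ((hk s hsS').mul_const m).const_sub 1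
  /- the jet links required by Part A, at every point of the rectangle -/
  have L_ss : ∀ s ∈ S, ∀ m ∈ W, HasDerivAt (fun s' => hs s' m) (hss s m) s := by
    intro s hsS' m hmW'
    have hJ0 := hJ s hsS' m hmW'
    have h0 := hasDerivAt_div_pow 2 ((hk2 s hsS').const_mul (c m)) (hJs s hsS' m) rfl hJ0
    have key := (hα2 s hsS').sub h0
    have hfun : (fun s' => hs s' m) = fun s' => α1 s' - c m * k1 s' / (1 - k s' * m) ^ 2 := by funext s'; simp only [hhs]
    rw [hfun]
    refine key.congr_deriv ?_
    simp only [hhss]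
    field_simp
    ring
  have L_m : ∀ s ∈ S, ∀ m ∈ W, HasDerivAt (fun m' => h s m') (hm s m) m := by
    intro s hsS' m hmW'
    have hJ0 := hJ s hsS' m hmW'
    have h0 := hasDerivAt_div_pow 1 ((hc m hmW').mul_const (k s)) (hJm s m) rfl hJ0
    have key := ((hg m hmW').const_add (α s)).sub h0
    have hfun : (fun m' => h s m') = fun m' => α s + g m' - c m' * k s / (1 - k s * m') ^ 1 := by
      funext m'; simp only [hh, pow_one]
    rw [hfun]
    refine key.congr_deriv ?_
    simp only [hhm]
    field_simp
    ring
  have L_mm : ∀ s ∈ S, ∀ m ∈ W, HasDerivAt (fun m' => hm s m') (hmm s m) m := by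
    intro s hsS' m hmW'
    have hJ0 := hJ s hsS' m hmW'
    have hA := hasDerivAt_div_pow 1 ((hc2 m hmW').const_mul (k s)) (hJm s m) rfl hJ0
    have hB := hasDerivAt_div_pow 2 ((hc m hmW').const_mul (k s ^ 2)) (hJm s m) rfl hJ0
    have key := ((hg2 m hmW').sub hA).sub hB
    have hfun : (fun m' => hm s m') = fun m' => g1 m' - k s * c1 m' / (1 - k s * m') ^ 1 - k s ^ 2 * c m' / (1 - k s * m') ^ 2 := by
      funext m'; simp only [hhm, pow_one]
    rw [hfun]
    refine key.congr_deriv ?_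
    simp only [hhmm]
    field_simp
    ring
  have L_mmm : ∀ s ∈ S, ∀ m ∈ W, HasDerivAt (fun m' => hmm s m') (hmmm s m) m := by
    intro s hsS' m hmW'
    have hJ0 := hJ s hsS' m hmW'
    have hA := hasDerivAt_div_pow 1 ((hc3 m hmW').const_mul (k s)) (hJm s m) rfl hJ0
    have hB := hasDerivAt_div_pow 2 ((hc2 m hmW').const_mul (2 * k s ^ 2)) (hJm s m) rfl hJ0
    have hC := hasDerivAt_div_pow 3 ((hc m hmW').const_mul (2 * k s ^ 3)) (hJm s m) rfl hJ0
    have key := (((hg3 m hmW').sub hA).sub hB).sub hC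
    have hfun : (fun m' => hmm s m') = fun m' => g2 m' - k s * c2 m' / (1 - k s * m') ^ 1 - 2 * k s ^ 2 * c1 m' / (1 - k s * m') ^ 2
        - 2 * k s ^ 3 * c m' / (1 - k s * m') ^ 3 := by
      funext m'; simp only [hhmm, pow_one]
    rw [hfun]
    refine key.congr_deriv ?_
    simp only [hhmmm]
    field_simp
    ring
  have L_sm : ∀ s ∈ S, ∀ m ∈ W, HasDerivAt (fun m' => hs s m') (hsm s m) m := by
    intro s hsS' m hmW'
    have hJ0 := hJ s hsS' m hmW'
    have hA := hasDerivAt_div_pow 2 ((hc m hmW').mul_const (k1 s)) (hJm s m) rfl hJ0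
    have key := (hasDerivAt_const m (α1 s)).sub hA
    have hfun : (fun m' => hs s m') = fun m' => α1 s - c m' * k1 s / (1 - k s * m') ^ 2 := by funext m'; simp only [hhs]
    rw [hfun]
    refine key.congr_deriv ?_
    simp only [hhsm]
    field_simp
    ring
  have L_ssm : ∀ s ∈ S, ∀ m ∈ W, HasDerivAt (fun m' => hss s m') (hssm s m) m := by
    intro s hsS' m hmW'
    have hJ0 := hJ s hsS' m hmW'
    have hA := hasDerivAt_div_pow 2 ((hc m hmW').mul_const (k2 s)) (hJm s m) rfl hJ0
    have hB' : HasDerivAt (fun m' => 2 * c m' * m' * k1 s ^ 2) ((2 * c1 m * m + 2 * c m * 1) * k1 s ^ 2) m := by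
      have key := (((hc m hmW').const_mul 2).mul (hasDerivAt_id m)).mul_const (k1 s ^ 2)
      have hfun : (fun m' => 2 * c m' * m' * k1 s ^ 2) = fun m' => 2 * c m' * id m' * k1 s ^ 2 := by funext m'; simp
      rw [hfun]
      exact key.congr_deriv (by simp)
    have hB := hasDerivAt_div_pow 3 hB' (hJm s m) rfl hJ0
    have key := ((hasDerivAt_const m (α2 s)).sub hA).sub hB
    have hfun : (fun m' => hss s m') = fun m' => α2 s - c m' * k2 s / (1 - k s * m') ^ 2 - 2 * c m' * m' * k1 s ^ 2 / (1 - k s * m') ^ 3 := by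
      funext m'; simp only [hhss]
    rw [hfun]
    refine key.congr_deriv ?_
    simp only [hhssm]
    field_simp
    ring
  -- (1′), (2′) in the jet currency
  have h1' : ∀ s ∈ S, ∀ m ∈ W, hs s m = (1 - k s * m) * Pm s m - k s * P s m := fun s hsS' m hmW' => by
    simp only [hhs]; exact h1 s hsS' m hmW'
  have h2' : ∀ s ∈ S, ∀ m ∈ W, Ps s m = -(1 - k s * m) * hm s m + k s * h s m + (1 - k s * m) * t m := fun s hsS' m hmW' => by
    simp only [hhm, hh]; exact h2 s hsS' m hmW'
  /- Part A's identity, then the explicit substitution -/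
  have hE2 := tower_identity_abstract hS hW hk ht ht2 L_ss L_m L_mm L_mmm L_sm L_ssm P_s P_m P_sm P_ms h1' h2' hsS hmW
  simp only [hh, hhs, hhss, hhm, hhmm, hhmmm, hhsm, hhssm] at hE2
  have hJne := hJ s hsS m hmW
  field_simp at hE2
  linear_combination -hE2

end explicitElim

end Summit.NavierStokesRegularity.NavierStokesRegularity.Theorems.PoloidalWindowDoorLrcModEntireCurvedTowerElim

end
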